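import Mathlib

/-!
# SoloBlindBoundaryTriality — two finite certificates behind THEOREM BM / PROPOSITION HEEG

Solo programme `solo-HodgeConjecture-blind`, session s55 (`work/s55/presentation-branches.md` §6).

## A. Boundary types of `M̄₃(Q₈)` (the group-theoretic half of the classification)

A one-nodal degeneration of an étale `Q₈`-cover of a genus-3 curve with vanishing cycle `δ′ = a₃` is
governed by `g = ρ(a₃)` and `H = ρ(π₁(Σ₃ ∖ a₃)) = ⟨ρ(a₁),ρ(b₁),ρ(a₂),ρ(b₂),ρ(a₃)⟩`.  The surface relation
`[ρa₁,ρb₁][ρa₂,ρb₂][ρa₃,ρb₃] = 1` shows: if `H` is abelian then `[g, ρ(b₃)] = 1`.  We certify over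
`Q₈ = QuaternionGroup 2` (by `decide`):

* `comm_dichotomy` : if `g h = h g` then `h ∈ {1, g, g², g³}` or `g² = 1` — the centraliser of an
  element of order 4 is the cyclic group it generates;
* `sq_one_iff_central`, `pow_four` : `g² = 1 ↔ g ∈ {1, −1}`, `g⁴ = 1`.

Hence ("no type B₄"): if `H` is cyclic of order 4 (so `ρ(b₃) ∉ H ∋ g`, `ρ` being onto) then `g² = 1`,
i.e. `g ∈ {1, −1}`; the abelian-Prym boundary with disconnected normalisation only occurs with local
monodromy `−1` (SB-C524).

## B. Triality bookkeeping for PROPOSITION HEEG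

Weights of the half-spin representations `S^±` of `D₄` are the vectors `(±½,±½,±½,±½)` with an even
(`S⁺`) resp. odd (`S⁻`) number of minus signs; weights of the vector representation `V₈ ⊇ T₈` are `±eᵢ`.
Encoding a half-weight as `Fin 4 → Bool` (`true = +½`) and the sum of two half-weights as the integer
vector `wsum s t : Fin 4 → ℤ` (entries in `{-1,0,1}`), we certify:

* `V_not_in_SpSp` : no two `S⁺`-weights sum to `e₁` — so `Hom(V₈, S⁺ ⊗ S⁺) = 0`: the transcendental
  lattice of the K3 surface does NOT sit in `H¹(A₊) ⊗ H¹(A₊)`;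
* `V_not_in_SmSm` : likewise for `S⁻ ⊗ S⁻`;
* `V_in_SpSm` : some `S⁺`-weight and `S⁻`-weight sum to `e₁` (indeed `V₈ ⊂ S⁺ ⊗ S⁻`): `T₈ ⊗ ℚ` lives in
  `H¹(A₊) ⊗ H¹(A₋)`;
* `spin7_plus`, `spin7_minus` : forgetting the last coordinate (the Cartan of `B₃ = Spin(7) ⊂ Spin(8)`,
  the generic Mumford–Tate group on a Noether–Lefschetz divisor, in the standard embedding) maps the 8
  weights of `S⁺`, and the 8 weights of `S⁻`, bijectively onto the 8 weights `(±½,±½,±½)` of the spin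
  representation of `B₃` — both half-spins restrict to the (irreducible) `spin₇`, so `End⁰(A₊)` does not
  grow on Noether–Lefschetz divisors while `A₊ ~ A₋` appears: 'Heegner' is invisible to endomorphisms
  (PROP HEEG, SB-C523), which is why THEOREM BM is a monodromy computation.

Only the finite combinatorics is certified here; the representation-theoretic dictionary (weights ↔
representations, `Mon° ⊂` derived Mumford–Tate) is classical and not formalised.
-/

namespace Summit.HodgeConjecture.HodgeConjecture.Theorems.BoundaryTriality

set_option maxHeartbeats 4000000
set_option linter.dupNamespace false

/-! ## A. `Q₈` -/

/-- `Q₈`. -/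
abbrev Q := QuaternionGroup 2

/-- `−1 = a 2`, the unique central involution. -/
def mone : Q := QuaternionGroup.a 2

/-- Every element has order dividing 4. -/
theorem pow_four : ∀ g : Q, g ^ 4 = 1 := by decide

/-- `g² = 1 ↔ g ∈ {1, −1}`. -/
theorem sq_one_iff : ∀ g : Q, g ^ 2 = 1 ↔ (g = 1 ∨ g = mone) := by decide

/-- `{1, −1}` is exactly the centre. -/
theorem sq_one_iff_central : ∀ g : Q, g ^ 2 = 1 ↔ ∀ h : Q, g * h = h * g := by decide

/-- Centraliser dichotomy: two commuting elements lie in a common cyclic group `⟨g⟩`, unless `g` is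
central.  ("No type B₄": an order-4 local monodromy `g` cannot commute with an element outside `⟨g⟩`.) -/
theorem comm_dichotomy : ∀ g h : Q, g * h = h * g →
    (h = 1 ∨ h = g ∨ h = g ^ 2 ∨ h = g ^ 3) ∨ g ^ 2 = 1 := by decide

/-- The form used in the text: `H = ⟨g'⟩` cyclic of order 4 containing `g`, `x ∉ H` commuting with `g`
forces `g` central (`g² = 1`). -/
theorem typeB_forces_central : ∀ g' g x : Q, g' ^ 2 ≠ 1 →
    (g = 1 ∨ g = g' ∨ g = g' ^ 2 ∨ g = g' ^ 3) →
    ¬ (x = 1 ∨ x = g' ∨ x = g' ^ 2 ∨ x = g' ^ 3) →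
    g * x = x * g → g ^ 2 = 1 := by decide

/-! ## B. Half-spin weights of `D₄` -/

/-- A half-weight `(±½,±½,±½,±½)`, `true = +½`. -/
abbrev HW := Fin 4 → Bool

/-- Number of minus signs. -/
def minus (s : HW) : ℕ := (List.finRange 4).countP fun i => s i = false

/-- `S⁺`: even number of minus signs. -/
def isPlus (s : HW) : Bool := minus s % 2 == 0

/-- Sum of two half-weights, as an integer vector. -/
def wsum (s t : HW) : Fin 4 → ℤ :=
  fun i => ((if s i then 1 else -1) + (if t i then 1 else -1)) / 2

/-- The weight `e₁` of the vector representation. -/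
def e1 : Fin 4 → ℤ := fun i => if i = 0 then 1 else 0

/-- `e₁` is not a weight of `S⁺ ⊗ S⁺`. -/
theorem V_not_in_SpSp : ∀ s t : HW, isPlus s = true → isPlus t = true → wsum s t ≠ e1 := by decide

/-- `e₁` is not a weight of `S⁻ ⊗ S⁻`. -/
theorem V_not_in_SmSm : ∀ s t : HW, isPlus s = false → isPlus t = false → wsum s t ≠ e1 := by decide

/-- `e₁` is a weight of `S⁺ ⊗ S⁻`. -/
theorem V_in_SpSm : ∃ s t : HW, isPlus s = true ∧ isPlus t = false ∧ wsum s t = e1 := by decide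

/-- Restriction to the Cartan of `B₃`: forget the last coordinate. -/
def restr (s : HW) : Fin 3 → Bool := fun i => s (Fin.castSucc i)

/-- The 8 weights of `S⁺` restrict bijectively onto the 8 weights of `spin₇`. -/
theorem spin7_plus : ∀ v : Fin 3 → Bool, ∃ s : HW, (isPlus s = true ∧ restr s = v) ∧
    ∀ s' : HW, isPlus s' = true ∧ restr s' = v → s' = s := by decide

/-- The 8 weights of `S⁻` restrict bijectively onto the 8 weights of `spin₇`. -/
theorem spin7_minus : ∀ v : Fin 3 → Bool, ∃ s : HW, (isPlus s = false ∧ restr s = v) ∧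
    ∀ s' : HW, isPlus s' = false ∧ restr s' = v → s' = s := by decide

end Summit.HodgeConjecture.HodgeConjecture.Theorems.BoundaryTriality
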